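import Summits.Schanuel.Schanuel.Theorems.ZilberEacInvariantDirectionExistence
import HarnessLib

/-!
# Invariant bases with NON-proportional degrees: existence with a decaying, drifting transversal

Zilber's Exponential-Algebraic Closedness, case ladder (host summit Schanuel, cell `pub-schanuel`,
seat 2, gen 11).  `ZilberEacInvariantDirectionExistence` treats `W = polyFibredGraph g A F` over a
base invariant under a lattice direction `q` (`g(x + zq) = g(x)`) when the degrees `dⱼ = deg Aⱼ` are
PROPORTIONAL to `q`: then the coupling `e^{g}` stays bounded along the shifted rays.  Here the
degrees are arbitrary: the moving lattice centres `c(m) = 2πi(mq + p) + ℓ(m)`,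
`ℓⱼ(m) = dⱼ log m + log aⱼ + o(1)`, DRIFT transversally by `(log m) d`, and by invariance
`g(c(m) + ξ) = g((log m) d + η)` with `η` bounded.  If `Re g_D(d) < 0` (`D = deg g ≥ 2`) then
`Re g ≤ -(c₀/2)(log m)^D` on the unit polydiscs — the coupling `e^{g} Fⱼ(e^{g}, x)` DECAYS
super-polynomially (so arbitrary `x`-dependent fibre polynomials are allowed, as in the puncture
regime) and the moving-polydisc contraction applies.

**THEOREM (`exists_solutions_invariantDrift`).**  `g` invariant under `q`, `deg g ≥ 2`,
`(Aⱼ)_{dⱼ}(2πiq) ≠ 0`, `Re g_D(d) < 0`, `Fⱼ ∈ ℂ[u, x]` arbitrary: for every label `p ∈ ℤˢ` there are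
solutions `x(m) = r(m) + 2πi m q` of `e^{xⱼ} = Aⱼ(x) + e^{g(x)}Fⱼ(e^{g(x)}, x)` (large `m`) with
`r(m) - (log m) d → 2πi p + log a`, `g(x(m)) = g(r(m))` and `(2πm)^N |e^{g(x(m))}| ≤ 1` for every `N`
eventually — the input of THEOREM L″ (`ZilberEacDriftingTransversal`); density:
`ZilberEacInvariantDriftDensity`.

HONEST FRAMING: an existence theorem for explicit families inside an OPEN cell; `EC(3,2)` OPEN;
NOT Schanuel's conjecture; EAC ⇏ SC.
-/

noncomputable section

open Complex MvPolynomial Metric Set Filter Topology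

set_option linter.dupNamespace false

namespace Summit.Schanuel.Schanuel.Theorems

section InvariantDrift

variable {s : ℕ}

set_option maxHeartbeats 400000 in
/-- **THEOREM (existence, invariant base, drifting transversal).**  See the module docstring. (new)
[cite: MantovaMasser2023, §1 p.5 (the open case dim π(V) = 2 in ℂ³×ℂˣ³)] -/
theorem exists_solutions_invariantDrift (g : MvPolynomial (Fin s) ℂ) (hD : 2 ≤ g.totalDegree)
    (q : Fin s → ℤ)
    (hper : ∀ (x : Fin s → ℂ) (z : ℂ), eval (x + z • fun j => (q j : ℂ)) g = eval x g)
    (A : Fin s → MvPolynomial (Fin s) ℂ)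
    (hA : ∀ j, eval (fun i => 2 * Real.pi * I * (q i : ℂ))
      (homogeneousComponent (A j).totalDegree (A j)) ≠ 0)
    (hneg : (eval (fun j => (((A j).totalDegree : ℕ) : ℂ))
      (homogeneousComponent g.totalDegree g)).re < 0)
    (F : Fin s → MvPolynomial (Fin (s + 1)) ℂ) (p : Fin s → ℤ) :
    ∃ (x r : ℕ → Fin s → ℂ),
      (∀ᶠ m : ℕ in atTop, ∀ j, exp (x m j) =
        eval (x m) (A j) + exp (eval (x m) g) * eval (Fin.cons (exp (eval (x m) g)) (x m)) (F j)) ∧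
      (∀ m, x m = r m + (2 * Real.pi * I * (m : ℂ)) • fun j => (q j : ℂ)) ∧
      (∀ m, eval (x m) g = eval (r m) g) ∧
      Tendsto (fun m : ℕ => r m - ((Real.log m : ℝ) : ℂ) • fun j => (((A j).totalDegree : ℕ) : ℂ))
        atTop (𝓝 fun j => 2 * Real.pi * I * (p j : ℂ) +
          log (eval (fun i => 2 * Real.pi * I * (q i : ℂ))
            (homogeneousComponent (A j).totalDegree (A j)))) ∧
      ∀ N : ℕ, ∀ᶠ m : ℕ in atTop,
        ‖(2 * Real.pi * I * (m : ℂ) : ℂ)‖ ^ N * ‖exp (eval (x m) g)‖ ≤ 1 := by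
  classical
  -- data: leading values `a`, the ratios `Aⱼ(m v)/(m^{dⱼ} aⱼ) → 1`
  obtain ⟨a, ha⟩ : ∃ a : Fin s → ℂ, a = fun j => eval (fun i => 2 * Real.pi * I * (q i : ℂ))
    (homogeneousComponent (A j).totalDegree (A j)) := ⟨_, rfl⟩
  have ha0 : ∀ j, a j ≠ 0 := fun j => by rw [ha]; exact hA j
  obtain ⟨d, hd⟩ : ∃ d : Fin s → ℂ, d = fun j => (((A j).totalDegree : ℕ) : ℂ) := ⟨_, rfl⟩
  obtain ⟨ratio, hratio⟩ : ∃ ratio : Fin s → ℕ → ℂ, ratio = fun j (m : ℕ) =>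
    eval (fun i => (m : ℂ) * (2 * Real.pi * I * (q i : ℂ))) (A j) /
      ((m : ℂ) ^ (A j).totalDegree * a j) := ⟨_, rfl⟩
  have hratio1 : ∀ j, Tendsto (ratio j) atTop (𝓝 1) := by
    intro j
    rw [hratio, ha]
    exact tendsto_latticeValue_div (A j) _ (hA j)
  have hlogratio : ∀ j, Tendsto (fun m => log (ratio j m)) atTop (𝓝 0) := by
    intro j
    have h := (hratio1 j).clog Complex.one_mem_slitPlane
    rwa [Complex.log_one] at h
  have hratio_ne : ∀ᶠ m : ℕ in atTop, ∀ j, ratio j m ≠ 0 :=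
    eventually_all.2 fun j => (hratio1 j).eventually (isOpen_ne.mem_nhds one_ne_zero)
  -- the logarithm branch, `y(m) = 2πi m`, the transversal part `rc(m)` (with drift), the centres
  obtain ⟨ℓ, hℓ⟩ : ∃ ℓ : ℕ → Fin s → ℂ, ℓ = fun (m : ℕ) j =>
    (((A j).totalDegree : ℕ) : ℂ) * log (m : ℂ) + log (a j) + log (ratio j m) := ⟨_, rfl⟩
  obtain ⟨y, hy⟩ : ∃ y : ℕ → ℂ, y = fun (m : ℕ) => 2 * Real.pi * I * (m : ℂ) := ⟨_, rfl⟩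
  obtain ⟨rp, hrp⟩ : ∃ rp : ℕ → Fin s → ℂ,
    rp = fun (m : ℕ) j => 2 * Real.pi * I * (p j : ℂ) + log (a j) + log (ratio j m) := ⟨_, rfl⟩
  obtain ⟨rc, hrc⟩ : ∃ rc : ℕ → Fin s → ℂ,
    rc = fun (m : ℕ) => rp m + (log (m : ℂ)) • d := ⟨_, rfl⟩
  obtain ⟨c, hc⟩ : ∃ c : ℕ → Fin s → ℂ, c = fun m => rc m + y m • fun j => (q j : ℂ) := ⟨_, rfl⟩
  have hc' : ∀ m j, c m j = (m : ℂ) * (2 * Real.pi * I * (q j : ℂ)) +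
      (2 * Real.pi * I * (p j : ℂ) + ℓ m j) := by
    intro m j
    simp only [hc, hrc, hrp, hy, hℓ, hd, Pi.add_apply, Pi.smul_apply, smul_eq_mul]
    ring
  -- the convergent part of the centres
  have hrp_lim : Tendsto rp atTop (𝓝 fun j => 2 * Real.pi * I * (p j : ℂ) + log (a j)) := by
    rw [hrp]
    refine tendsto_pi_nhds.2 fun j => ?_
    have h := (hlogratio j).const_add (2 * Real.pi * I * (p j : ℂ) + log (a j))
    rwa [add_zero] at h
  have hrp_bdd : ∀ᶠ m : ℕ in atTop,
      ‖rp m‖ ≤ ‖fun j => 2 * Real.pi * I * (p j : ℂ) + log (a j)‖ + 1 := by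
    have h := hrp_lim
    rw [tendsto_iff_norm_sub_tendsto_zero] at h
    filter_upwards [h.eventually (gt_mem_nhds zero_lt_one)] with m hm
    have := norm_le_norm_add_norm_sub' (rp m) (fun j => 2 * Real.pi * I * (p j : ℂ) + log (a j))
    linarith [hm.le]
  -- (C1) `exp c(m)ⱼ = Aⱼ(m v)` eventually
  have hcexp : ∀ᶠ m : ℕ in atTop, ∀ j,
      exp (c m j) = eval (fun k => (m : ℂ) * (2 * Real.pi * I * (q k : ℂ))) (A j) := by
    filter_upwards [hratio_ne, eventually_ge_atTop 1] with m hm hm1 j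
    have hmC : (m : ℂ) ≠ 0 := by exact_mod_cast (show m ≠ 0 by omega)
    rw [hc', Complex.exp_add, exp_natCast_mul_twoPiI_mul_intCast, one_mul, Complex.exp_add,
      exp_two_pi_I_mul_intCast, one_mul, hℓ]
    dsimp only
    rw [Complex.exp_add, Complex.exp_add, Complex.exp_log (ha0 j), Complex.exp_log (hm j),
      Complex.exp_nat_mul, Complex.exp_log hmC, hratio]
    dsimp only
    have hden : (m : ℂ) ^ (A j).totalDegree * a j ≠ 0 := mul_ne_zero (pow_ne_zero _ hmC) (ha0 j)
    rw [mul_div_assoc', mul_comm ((m : ℂ) ^ (A j).totalDegree * a j), mul_div_assoc,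
      div_self hden, mul_one]
  -- (C2) `‖c(m) - m v‖ = O(log m)`
  have hcsmall : ∀ δ : ℝ, 0 < δ → ∀ᶠ m : ℕ in atTop,
      ‖c m - fun i => (m : ℂ) * (2 * Real.pi * I * (q i : ℂ))‖ + 1 ≤ δ * m := by
    intro δ hδ
    set K : ℝ := ∑ j, (‖(2 * Real.pi * I * (p j : ℂ) : ℂ)‖ + ‖log (a j)‖) + 2 with hK
    set Dg : ℝ := ∑ j, ((A j).totalDegree : ℝ) with hDg
    have hlog1 : ∀ j, ∀ᶠ m : ℕ in atTop, ‖log (ratio j m)‖ ≤ 1 := by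
      intro j
      have h := (hlogratio j)
      rw [tendsto_zero_iff_norm_tendsto_zero] at h
      filter_upwards [h.eventually (gt_mem_nhds zero_lt_one)] with m hm
      exact hm.le
    filter_upwards [eventually_all.2 hlog1, eventually_mul_log_add_le Dg K hδ, eventually_ge_atTop 1]
      with m hm hmδ hm1
    have hlogm : 0 ≤ Real.log m := Real.log_nonneg (by exact_mod_cast hm1)
    have hnlog : ‖log (m : ℂ)‖ = Real.log m := by
      rw [← Complex.natCast_log, Complex.norm_real, Real.norm_eq_abs, abs_of_nonneg hlogm]
    have hcomp : ∀ j, ‖(c m - fun i => (m : ℂ) * (2 * Real.pi * I * (q i : ℂ))) j‖ ≤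
        Dg * Real.log m + (K - 1) := by
      intro j
      have e : (c m - fun i => (m : ℂ) * (2 * Real.pi * I * (q i : ℂ))) j =
          2 * Real.pi * I * (p j : ℂ) + ℓ m j := by
        rw [Pi.sub_apply, hc']; ring
      rw [e, hℓ]
      dsimp only
      have hdj : ((A j).totalDegree : ℝ) ≤ Dg :=
        Finset.single_le_sum (f := fun j => ((A j).totalDegree : ℝ)) (fun _ _ => by positivity)
          (Finset.mem_univ j)
      have hKj : ‖(2 * Real.pi * I * (p j : ℂ) : ℂ)‖ + ‖log (a j)‖ ≤ K - 2 := by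
        have := Finset.single_le_sum
          (f := fun j => ‖(2 * Real.pi * I * (p j : ℂ) : ℂ)‖ + ‖log (a j)‖)
          (fun _ _ => by positivity) (Finset.mem_univ j)
        rw [hK]; linarith
      have hn1 : ‖(((A j).totalDegree : ℕ) : ℂ) * log (m : ℂ)‖ = (A j).totalDegree * Real.log m := by
        rw [norm_mul, Complex.norm_natCast, hnlog]
      have h3 := norm_add₃_le (a := (((A j).totalDegree : ℕ) : ℂ) * log (m : ℂ)) (b := log (a j))
        (c := log (ratio j m))
      calc ‖2 * Real.pi * I * (p j : ℂ) +
            ((((A j).totalDegree : ℕ) : ℂ) * log (m : ℂ) + log (a j) + log (ratio j m))‖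
          ≤ ‖(2 * Real.pi * I * (p j : ℂ) : ℂ)‖ +
            ‖(((A j).totalDegree : ℕ) : ℂ) * log (m : ℂ) + log (a j) + log (ratio j m)‖ :=
            norm_add_le _ _
        _ ≤ ‖(2 * Real.pi * I * (p j : ℂ) : ℂ)‖ +
            (‖(((A j).totalDegree : ℕ) : ℂ) * log (m : ℂ)‖ + ‖log (a j)‖ + ‖log (ratio j m)‖) := by
            linarith
        _ ≤ Dg * Real.log m + (K - 1) := by
            rw [hn1]
            nlinarith [hm j, hdj, hKj, hlogm]
    have hD0 : 0 ≤ Dg := by rw [hDg]; exact Finset.sum_nonneg fun j _ => Nat.cast_nonneg _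
    have hK2 : 2 ≤ K := by
      rw [hK]
      have := Finset.sum_nonneg fun j (_ : j ∈ (Finset.univ : Finset (Fin s))) =>
        (show 0 ≤ ‖(2 * Real.pi * I * (p j : ℂ) : ℂ)‖ + ‖log (a j)‖ by positivity)
      linarith
    have hnn : 0 ≤ Dg * Real.log m + (K - 1) := by
      have := mul_nonneg hD0 hlogm
      linarith
    have hnorm : ‖c m - fun i => (m : ℂ) * (2 * Real.pi * I * (q i : ℂ))‖ ≤
        Dg * Real.log m + (K - 1) :=
      (pi_norm_le_iff_of_nonneg hnn).2 hcomp
    linarith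
  -- invariance: `g(c(m) + ξ) = g(rc(m) + ξ)`
  have hinv : ∀ m ξ, eval (c m + ξ) g = eval (rc m + ξ) g := by
    intro m ξ
    rw [hc]
    dsimp only
    rw [show rc m + y m • (fun j => (q j : ℂ)) + ξ = (rc m + ξ) + y m • fun j => (q j : ℂ) by abel,
      hper]
  -- (C3) DECAY: `Re g(rc(m) + ξ) ≤ -(M log m) - M` on `‖ξ‖ ≤ 1`, for every `M`
  have hdecay : ∀ M : ℝ, ∀ᶠ m : ℕ in atTop, ∀ ξ : Fin s → ℂ, ‖ξ‖ ≤ 1 →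
      (eval (rc m + ξ) g).re ≤ -(M * Real.log m) - M := by
    intro M
    set c₀ : ℝ := -(eval d (homogeneousComponent g.totalDegree g)).re with hc₀
    have hc₀pos : 0 < c₀ := by rw [hc₀, hd]; linarith
    obtain ⟨ρ, hρ, t₀, ht₀, hnear⟩ :=
      Literature.NumberTheory.Transcendental.ExpDominant.eval_smul_near_top g d (half_pos hc₀pos)
    set R : ℝ := ‖fun j => 2 * Real.pi * I * (p j : ℂ) + log (a j)‖ + 1 with hR
    have hlogT : Tendsto (fun m : ℕ => Real.log m) atTop atTop :=
      Real.tendsto_log_atTop.comp tendsto_natCast_atTop_atTop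
    filter_upwards [hrp_bdd, hlogT.eventually_ge_atTop t₀, hlogT.eventually_ge_atTop 1,
      hlogT.eventually_ge_atTop ((R + 1) / ρ), hlogT.eventually_ge_atTop (4 * |M| / c₀ + 1),
      eventually_ge_atTop 1] with m hm ht hl1 hlρ hlM hm1 ξ hξ
    set τ : ℝ := Real.log m with hτ
    have hτ0 : 0 < τ := by linarith
    -- `rc m + ξ = τ • (d + ζ)` with `ζ = (rp m + ξ)/τ`
    set η : Fin s → ℂ := rp m + ξ with hη
    have hηn : ‖η‖ ≤ R + 1 := (norm_add_le _ _).trans (by linarith)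
    set ζ : Fin s → ℂ := (τ : ℂ)⁻¹ • η with hζ
    have hτC : (τ : ℂ) ≠ 0 := by exact_mod_cast hτ0.ne'
    have hζn : ‖ζ‖ ≤ ρ := by
      rw [hζ, norm_smul, norm_inv, Complex.norm_real, Real.norm_eq_abs, abs_of_pos hτ0]
      rw [inv_mul_le_iff₀ hτ0]
      calc ‖η‖ ≤ R + 1 := hηn
        _ ≤ τ * ρ := by rw [div_le_iff₀ hρ] at hlρ; linarith
    have hsplit : rc m + ξ = (τ : ℂ) • (d + ζ) := by
      rw [hrc]
      dsimp only
      rw [smul_add, hζ, smul_smul, mul_inv_cancel₀ hτC, one_smul, hη, hτ, Complex.natCast_log]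
      abel
    have hn := hnear τ ht ζ hζn
    rw [← hsplit] at hn
    have hmain : ((τ : ℂ) ^ g.totalDegree * eval d (homogeneousComponent g.totalDegree g)).re =
        -(c₀ * τ ^ g.totalDegree) := by
      rw [← Complex.ofReal_pow, Complex.re_ofReal_mul, hc₀]; ring
    have hre : (eval (rc m + ξ) g).re ≤ -(c₀ / 2 * τ ^ g.totalDegree) := by
      have h1 := Complex.abs_re_le_norm (eval (rc m + ξ) g -
        (τ : ℂ) ^ g.totalDegree * eval d (homogeneousComponent g.totalDegree g))
      rw [Complex.sub_re, hmain, abs_le] at h1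
      nlinarith [h1.2, hn]
    -- `(c₀/2) τ^D ≥ (c₀/2) τ² ≥ 2|M| τ ≥ M τ + M`
    have hτD : τ ^ 2 ≤ τ ^ g.totalDegree := pow_le_pow_right₀ hl1 hD
    have hM1 : |M| * τ + |M| ≤ c₀ / 2 * τ ^ 2 := by
      have h1 : 4 * |M| / c₀ + 1 ≤ τ := hlM
      have h2 : 4 * |M| ≤ c₀ * (τ - 1) := by
        rw [div_add_one (ne_of_gt hc₀pos), div_le_iff₀ hc₀pos] at h1; nlinarith
      have hM0 := abs_nonneg M
      nlinarith [h2, hl1, hM0]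
    have hMle : M * Real.log m + M ≤ |M| * τ + |M| := by
      rw [← hτ]; nlinarith [le_abs_self M, hτ0]
    nlinarith [hre, hτD, hM1, hMle, hc₀pos]
  -- the perturbation and its smallness
  obtain ⟨P, hP⟩ : ∃ P : ℕ → Fin s → (Fin s → ℂ) → ℂ,
    P = fun _ j x => exp (eval x g) * eval (Fin.cons (exp (eval x g)) x : Fin (s + 1) → ℂ) (F j) :=
    ⟨_, rfl⟩
  have hPdiff : ∀ᶠ m : ℕ in atTop, ∀ j, DifferentiableOn ℂ (P m j) (ball (c m) 1) := by
    filter_upwards with m j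
    rw [hP]
    have h1 : Differentiable ℂ fun x : Fin s → ℂ => exp (eval x g) :=
      (differentiable_mvPolynomial_eval g).cexp
    exact (h1.mul ((differentiable_mvPolynomial_eval (F j)).comp
      (differentiable_finCons h1))).differentiableOn
  -- size of the centres
  have hcK : ∀ᶠ m : ℕ in atTop, ‖c m‖ + 1 ≤ (‖fun i => 2 * Real.pi * I * (q i : ℂ)‖ + 1) * m := by
    filter_upwards [hcsmall 1 one_pos] with m hm
    have h1 : ‖c m‖ ≤ ‖c m - fun i => (m : ℂ) * (2 * Real.pi * I * (q i : ℂ))‖ +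
        ‖fun i => (m : ℂ) * (2 * Real.pi * I * (q i : ℂ))‖ := norm_le_norm_sub_add _ _
    have h2 : ‖fun i => (m : ℂ) * (2 * Real.pi * I * (q i : ℂ))‖ =
        (m : ℝ) * ‖fun i => 2 * Real.pi * I * (q i : ℂ)‖ := by
      have : (fun i => (m : ℂ) * (2 * Real.pi * I * (q i : ℂ))) =
          (m : ℂ) • fun i => 2 * Real.pi * I * (q i : ℂ) := by
        funext i; simp [Pi.smul_apply, smul_eq_mul]
      rw [this, norm_smul, Complex.norm_natCast]
    nlinarith [h1, h2, hm, norm_nonneg (fun i => 2 * Real.pi * I * (q i : ℂ))]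
  have hPsmall : ∀ j, ∀ θ : ℝ, 0 < θ → ∀ᶠ m : ℕ in atTop, ∀ ξ : Fin s → ℂ, ‖ξ‖ < 1 →
      ‖P m j (c m + ξ)‖ ≤ θ * (m : ℝ) ^ (A j).totalDegree := by
    intro j θ hθ
    obtain ⟨CF, hCF, NF, hCN⟩ :=
      Literature.NumberTheory.Transcendental.HypersurfaceCover.exists_norm_eval_le_pow (F j)
    set Kq : ℝ := ‖fun i => 2 * Real.pi * I * (q i : ℂ)‖ + 1 with hKq
    have hKq1 : 1 ≤ Kq := by have := norm_nonneg (fun i => 2 * Real.pi * I * (q i : ℂ)); linarith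
    filter_upwards [hdecay ((NF : ℝ) + 1), hcK,
      (tendsto_natCast_atTop_atTop.const_mul_atTop hθ).eventually_ge_atTop (CF * (2 + Kq) ^ NF),
      eventually_ge_atTop 1] with m hmd hmK hmθ hm1 ξ hξ
    have hm1' : (1 : ℝ) ≤ m := by exact_mod_cast hm1
    have hm0 : (0 : ℝ) < m := by linarith
    rw [hP]
    dsimp only
    rw [hinv m ξ]
    set x := c m + ξ with hx
    have hre : (eval (rc m + ξ) g).re ≤ -(((NF : ℝ) + 1) * Real.log m) - ((NF : ℝ) + 1) := hmd ξ hξ.le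
    have hlog0 : 0 ≤ Real.log m := Real.log_nonneg hm1'
    -- `|e^{g}| ≤ m^{-(NF+1)}` and `≤ 1`
    have hexp_le : ‖exp (eval (rc m + ξ) g)‖ ≤ ((m : ℝ) ^ (NF + 1))⁻¹ := by
      rw [Complex.norm_exp]
      refine (Real.exp_le_exp.mpr (hre.trans (show -(((NF : ℝ) + 1) * Real.log m) - ((NF : ℝ) + 1) ≤
        -(((NF + 1 : ℕ) : ℝ) * Real.log m) by push_cast; nlinarith))).trans ?_
      rw [Real.exp_neg, Real.exp_nat_mul, Real.exp_log hm0]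
    have hexp_le1 : ‖exp (eval (rc m + ξ) g)‖ ≤ 1 := by
      refine hexp_le.trans ?_
      rw [inv_le_one_iff₀]
      exact Or.inr (one_le_pow₀ hm1')
    have hxn : ‖x‖ ≤ Kq * m := by
      calc ‖x‖ ≤ ‖c m‖ + ‖ξ‖ := norm_add_le _ _
        _ ≤ ‖c m‖ + 1 := by linarith [hξ.le]
        _ ≤ Kq * m := hmK
    have hcons : ‖(Fin.cons (exp (eval (rc m + ξ) g)) x : Fin (s + 1) → ℂ)‖ ≤ 1 + Kq * m :=
      norm_finCons_le hexp_le1 (by positivity) hxn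
    have hFb : ‖eval (Fin.cons (exp (eval (rc m + ξ) g)) x) (F j)‖ ≤ CF * ((2 + Kq) * m) ^ NF := by
      refine (hCN _).trans (mul_le_mul_of_nonneg_left ?_ hCF)
      refine pow_le_pow_left₀ (by positivity) ?_ _
      nlinarith
    calc ‖exp (eval (rc m + ξ) g) * eval (Fin.cons (exp (eval (rc m + ξ) g)) x) (F j)‖
        = ‖exp (eval (rc m + ξ) g)‖ * ‖eval (Fin.cons (exp (eval (rc m + ξ) g)) x) (F j)‖ :=
          norm_mul _ _
      _ ≤ ((m : ℝ) ^ (NF + 1))⁻¹ * (CF * ((2 + Kq) * m) ^ NF) :=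
          mul_le_mul hexp_le hFb (norm_nonneg _) (by positivity)
      _ = CF * (2 + Kq) ^ NF / m := by
          rw [mul_pow, pow_succ]
          field_simp
      _ ≤ θ := by rw [div_le_iff₀ hm0]; exact hmθ
      _ ≤ θ * (m : ℝ) ^ (A j).totalDegree :=
          le_mul_of_one_le_right hθ.le (one_le_pow₀ hm1')
  -- (C5) solutions near the centres, and a sequence with `x(m) - c(m) → 0`
  have hsol : ∀ ε : ℝ, 0 < ε → ∀ᶠ m : ℕ in atTop, ∃ x ∈ {x : Fin s → ℂ |
      ∀ j, exp (x j) = eval x (A j) + P m j x}, ‖x - c m‖ ≤ ε := by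
    intro ε hε
    filter_upwards [exists_exp_eq_poly_add_near_centre q A hA c hcexp hcsmall P hPdiff hPsmall hε]
      with m hm
    obtain ⟨x, hx, hsol⟩ := hm
    exact ⟨x, hsol, hx⟩
  obtain ⟨x, hxS, hxc⟩ := exists_seq_of_forall_eventually_exists_near _ c hsol
  have hxnear : ∀ᶠ m : ℕ in atTop, ‖x m - c m‖ ≤ 1 := by
    have h := hxc
    rw [tendsto_zero_iff_norm_tendsto_zero] at h
    filter_upwards [h.eventually (gt_mem_nhds zero_lt_one)] with m hm
    exact hm.le
  have hxsplit : ∀ m, x m - y m • (fun j => (q j : ℂ)) = rc m + (x m - c m) := by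
    intro m; rw [hc]; dsimp only; abel
  refine ⟨x, fun m => x m - y m • fun j => (q j : ℂ), ?_, fun m => ?_, fun m => ?_, ?_, fun N => ?_⟩
  · filter_upwards [hxS] with m hm j
    have h := hm j
    rw [hP] at h
    exact h
  · simp only [hy, sub_add_cancel]
  · have h := hper (x m - y m • fun j => (q j : ℂ)) (y m)
    rw [sub_add_cancel] at h
    dsimp only
    exact h
  · -- `r(m) - (log m) d = (x(m) - c(m)) + rp(m) → 0 + r_p`
    have he : (fun m : ℕ => x m - y m • (fun j => (q j : ℂ)) -
        ((Real.log m : ℝ) : ℂ) • fun j => (((A j).totalDegree : ℕ) : ℂ)) =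
        fun m => (x m - c m) + rp m := by
      funext m
      rw [hc, hrc, hd, Complex.natCast_log]
      dsimp only
      abel
    rw [he]
    simp only [ha] at hrp_lim
    have h := hxc.add hrp_lim
    rw [zero_add] at h
    exact h
  · -- decay along the solutions: `(2πm)^N |e^{g(x(m))}| ≤ 1`
    filter_upwards [hdecay (8 * N), hxnear, eventually_ge_atTop 1] with m hmd hmx hm1
    have hm1' : (1 : ℝ) ≤ m := by exact_mod_cast hm1
    have hm0 : (0 : ℝ) < m := by linarith
    have hgx : eval (x m) g = eval (rc m + (x m - c m)) g := by
      have h := hper (x m - y m • fun j => (q j : ℂ)) (y m)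
      rw [sub_add_cancel] at h
      rw [h, hxsplit]
    have hre := hmd (x m - c m) hmx
    rw [← hgx] at hre
    have hnorm : ‖(2 * Real.pi * I * (m : ℂ) : ℂ)‖ = 2 * Real.pi * m := by
      rw [show (2 * Real.pi * I * (m : ℂ) : ℂ) = ((2 * Real.pi * (m : ℝ) : ℝ) : ℂ) * I by
        push_cast; ring, norm_mul, Complex.norm_I, mul_one, Complex.norm_real, Real.norm_eq_abs,
        abs_of_pos (by positivity)]
    rw [hnorm, Complex.norm_exp]
    have h2pm : 0 < 2 * Real.pi * (m : ℝ) := by positivity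
    have hpow : (2 * Real.pi * (m : ℝ)) ^ N = Real.exp (N * Real.log (2 * Real.pi * m)) := by
      rw [Real.exp_nat_mul, Real.exp_log h2pm]
    rw [hpow, ← Real.exp_add]
    refine Real.exp_le_one_iff.2 ?_
    have hlog2pm : Real.log (2 * Real.pi * m) = Real.log (2 * Real.pi) + Real.log m := by
      rw [Real.log_mul Real.two_pi_pos.ne' hm0.ne']
    rw [hlog2pm]
    have hN0 : (0 : ℝ) ≤ N := Nat.cast_nonneg N
    have hlogm0 : 0 ≤ Real.log m := Real.log_nonneg hm1'
    have hl2p : Real.log (2 * Real.pi) ≤ 7 := by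
      have h := Real.log_le_sub_one_of_pos Real.two_pi_pos
      linarith [Real.pi_le_four]
    have h1 : (N : ℝ) * Real.log (2 * Real.pi) ≤ N * 7 := mul_le_mul_of_nonneg_left hl2p hN0
    have h2 : 0 ≤ (N : ℝ) * Real.log m := mul_nonneg hN0 hlogm0
    rw [mul_add]
    linarith [hre, h1, h2]

end InvariantDrift

end Summit.Schanuel.Schanuel.Theorems
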